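import Literature.Computability.Cryptography.CubicClassTableSemDescend
import HarnessLib

/-!
# Semantics of the class-group table, VI: the guarded baby steps and the target decomposition

Topic `Computability/Cryptography`; theorem-only sequel of `CubicClassTableSemDescend.lean` (crux
`LinnikCubicClassGroups.PureCubicClassGroupFBQP`, line `arakelov-giant-step-cycle`). In the context of that file:

* `log_chain_six_gap` — the six-gap `2 σ₁θ(i) ≤ σ₁θ(i+6)` in logarithmic form: `log σ₁θ(n) − log σ₁θ(0) ≥ ⌊n/6⌋ log 2`;
* `WalkFns.babyStepc_eq` — the guarded baby step is `stepc` when it fires;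
* `WalkFns.babySteps_sem` — **the final guarded baby steps** towards `X = t⋆`: starting from a code of `θ(0)⁻¹ A` at residual
  `0 ≤ X − pos ≤ C` with `C < 2^prec ⌊Bb/6⌋ log 2 − Bb`, after `Bb` guarded steps the state codes `θ(n)⁻¹ A` for some `n`
  with `2^prec ⌊n/6⌋ log 2 − n ≤ C`, the position advanced by `2^prec (log σ₁θ(n) − log σ₁θ(0)) ± n`, and the residual in
  `[0, l)` where `l` is the certified log of the NEXT gap (the guard has failed: the walk stops just left of the target);
* `WalkFns.tstarc_decomp` — `t⋆ = t̂ + N · Rint` with `Rint ≤ t⋆ − pos(b_E) < 2 Rint`, hence `|N − pos(b_E)/Rint| ≤ 3`.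
[Buchmann–Williams 1988, §3; Hallgren 2005, §4]

## References

* J. Buchmann, H. C. Williams, Math. Comp. 50 (1988), §3. [BuchmannWilliams1988]
* S. Hallgren, STOC 2005, §4. [Hallgren2005]
-/

noncomputable section

namespace Literature.Computability.Cryptography

namespace CubicClassTable

open Literature.NumberTheory.CubicFields Literature.NumberTheory.CubicFields.PureCubicCodes
open scoped NumberField nonZeroDivisors
open NumberField

/-- **The six-gap in logarithmic form**: if `a : ℤ → ℝ` is positive, monotone and `2 a i ≤ a (i + 6)`, then
`log a n − log a 0 ≥ ⌊n/6⌋ log 2` for `n : ℕ`. [cite: BuchmannWilliams1988, §3] -/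
theorem log_chain_six_gap {a : ℤ → ℝ} (hpos : ∀ i, 0 < a i) (hmono : Monotone a) (h6 : ∀ i, 2 * a i ≤ a (i + 6))
    (n : ℕ) : ((n / 6 : ℕ) : ℝ) * Real.log 2 ≤ Real.log (a n) - Real.log (a 0) := by
  have hq : ∀ q : ℕ, (q : ℝ) * Real.log 2 ≤ Real.log (a (6 * q : ℕ)) - Real.log (a 0) := by
    intro q
    induction q with
    | zero => simp
    | succ q ih =>
      have h := h6 (6 * q : ℕ)
      have hl : Real.log 2 + Real.log (a (6 * q : ℕ)) ≤ Real.log (a (6 * (q + 1) : ℕ)) := by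
        rw [← Real.log_mul (by norm_num) (hpos _).ne']
        refine Real.log_le_log (by linarith [hpos ((6 * q : ℕ) : ℤ)]) ?_
        have e : (((6 * (q + 1) : ℕ)) : ℤ) = ((6 * q : ℕ) : ℤ) + 6 := by push_cast; ring
        rw [e]; exact h
      push_cast at ih hl ⊢
      linarith
  have hmono' : Real.log (a (6 * (n / 6) : ℕ)) ≤ Real.log (a n) :=
    Real.log_le_log (hpos _) (hmono (by exact_mod_cast Nat.mul_div_le n 6))
  linarith [hq (n / 6)]

namespace WalkFns

section Baby

variable {K : Type*} [Field K] [NumberField K] {θ : K} {σ₁ : K →+* ℝ} {σ₂ : K →+* ℂ} {F : WalkFns} {I : Inst}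
variable (hdeg : Module.finrank ℚ K = 3) (hσ₂ : ∃ z : K, starRingEnd ℂ (σ₂ z) ≠ σ₂ z)
  (ε : (𝓞 K)ˣ) (hε : 1 < σ₁ (algebraMap (𝓞 K) K ε))
  (hab : Squarefree (I.a * I.b)) (hab1 : I.a * I.b ≠ 1) (hθ : θ ^ 3 = ((I.a * I.b ^ 2 : ℕ) : K))
  (hred : RedSem F I.a I.b K θ σ₁ σ₂)
  {cap : ℕ} (hcap : (243 * I.a ^ 2 * I.b ^ 2) ^ 2 ≤ cap)

/-- The guarded baby step is `stepc` when it fires, the identity otherwise. [folklore] -/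
theorem babyStepc_eq (F : WalkFns) (I : Inst) (cap v : ℕ) (st : PLat) :
    F.babyStepc I cap v st = if st.2 + (F.redc I cap st.1).2 ≤ F.tstarc I cap v then F.stepc I cap st else st := by
  unfold babyStepc stepc; rfl

include hdeg hσ₂ hε hab hab1 hθ hred hcap in
/-- **The final guarded baby steps.** For a nonzero `A`, `x₀ ∈ posRelMinima A`, `θ = voronoiChain A x₀` with the six-gap,
a state `st` coding `θ(0)⁻¹ A` at residual `0 ≤ t⋆ − pos ≤ C`, `C < 2^prec ⌊Bb/6⌋ log 2 − Bb`: after `Bb` guarded steps the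
state codes `θ(n)⁻¹ A`, `2^prec ⌊n/6⌋ log 2 − n ≤ C`, position `pos + 2^prec (log σ₁θ(n) − log σ₁θ(0)) ± n`, residual in
`[0, l)` with `|l − 2^prec (log σ₁θ(n+1) − log σ₁θ(n))| ≤ 1`. [cite: BuchmannWilliams1988, §3] -/
theorem babySteps_sem (v : ℕ) {A : FractionalIdeal (𝓞 K)⁰ K} {x₀ : K} (hx₀ : x₀ ∈ posRelMinima σ₁ σ₂ A)
    (h6 : ∀ i : ℤ, 2 * σ₁ (voronoiChain σ₁ σ₂ A x₀ i) ≤ σ₁ (voronoiChain σ₁ σ₂ A x₀ (i + 6)))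
    {st : PLat} (hc : Canon st.1)
    (hm : ∀ φ : K, Mem θ I.b st.1 φ ↔ φ ∈ FractionalIdeal.spanSingleton (𝓞 K)⁰ (voronoiChain σ₁ σ₂ A x₀ 0)⁻¹ * A)
    (hρ : 0 ≤ F.tstarc I cap v - st.2) {C : ℝ} (hC : ((F.tstarc I cap v - st.2 : ℤ) : ℝ) ≤ C)
    (hBb : C < 2 ^ I.prec * ((I.Bb / 6 : ℕ) : ℝ) * Real.log 2 - I.Bb) :
    ∃ n : ℕ, Canon ((F.babyStepc I cap v)^[I.Bb] st).1 ∧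
      (∀ φ : K, Mem θ I.b ((F.babyStepc I cap v)^[I.Bb] st).1 φ ↔
        φ ∈ FractionalIdeal.spanSingleton (𝓞 K)⁰ (voronoiChain σ₁ σ₂ A x₀ n)⁻¹ * A) ∧
      |((((F.babyStepc I cap v)^[I.Bb] st).2 - st.2 : ℤ) : ℝ) - 2 ^ I.prec *
          (Real.log (σ₁ (voronoiChain σ₁ σ₂ A x₀ n)) - Real.log (σ₁ (voronoiChain σ₁ σ₂ A x₀ 0)))| ≤ n ∧
      2 ^ I.prec * ((n / 6 : ℕ) : ℝ) * Real.log 2 - n ≤ C ∧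
      0 ≤ F.tstarc I cap v - ((F.babyStepc I cap v)^[I.Bb] st).2 ∧
      F.tstarc I cap v - ((F.babyStepc I cap v)^[I.Bb] st).2 < (F.redc I cap ((F.babyStepc I cap v)^[I.Bb] st).1).2 ∧
      |((F.redc I cap ((F.babyStepc I cap v)^[I.Bb] st).1).2 : ℝ) - 2 ^ I.prec *
          (Real.log (σ₁ (voronoiChain σ₁ σ₂ A x₀ (n + 1))) - Real.log (σ₁ (voronoiChain σ₁ σ₂ A x₀ n)))| ≤ 1 := by
  set X : ℤ := F.tstarc I cap v with hX
  have hmem := fun i => voronoiChain_mem hdeg hσ₂ ε hε hx₀ i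
  have hpos : ∀ i, 0 < σ₁ (voronoiChain σ₁ σ₂ A x₀ i) := fun i => (hmem i).2
  have hmono : Monotone fun i => σ₁ (voronoiChain σ₁ σ₂ A x₀ i) := (voronoiChain_strictMono hdeg hσ₂ ε hε hx₀).monotone
  set G : ℤ → ℝ := fun i => Real.log (σ₁ (voronoiChain σ₁ σ₂ A x₀ i)) with hG
  -- invariant after `k` guarded steps
  set Q : ℕ → PLat → Prop := fun k st' => ∃ n : ℕ, n ≤ k ∧ Canon st'.1 ∧
      (∀ φ : K, Mem θ I.b st'.1 φ ↔ φ ∈ FractionalIdeal.spanSingleton (𝓞 K)⁰ (voronoiChain σ₁ σ₂ A x₀ n)⁻¹ * A) ∧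
      |((st'.2 - st.2 : ℤ) : ℝ) - 2 ^ I.prec * (G n - G 0)| ≤ n ∧ 0 ≤ X - st'.2 ∧
      (¬ (st'.2 + (F.redc I cap st'.1).2 ≤ X) ∨ n = k) with hQ
  have hQ0 : Q 0 st := ⟨0, le_rfl, hc, by simpa using hm, by simp, hρ, Or.inr rfl⟩
  have hstep : ∀ k st', Q k st' → Q (k + 1) (F.babyStepc I cap v st') := by
    rintro k st' ⟨n, hn, hc', hm', herr', hρ', hdisj⟩
    rw [babyStepc_eq, ← hX]
    by_cases hg : st'.2 + (F.redc I cap st'.1).2 ≤ X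
    · rw [if_pos hg]
      obtain ⟨hc'', hm'', herr'', -, -⟩ := stepc_chain hdeg hσ₂ ε hε hab hab1 hθ hred hcap hx₀ (n : ℤ) hc' hm'
      have hn' : n = k := hdisj.resolve_left (not_not.mpr hg)
      refine ⟨n + 1, by omega, hc'', by exact_mod_cast hm'', ?_, ?_, Or.inr (by omega)⟩
      · have e : (((F.stepc I cap st').2 - st.2 : ℤ) : ℝ) = (((F.stepc I cap st').2 - st'.2 : ℤ) : ℝ) + ((st'.2 - st.2 : ℤ) : ℝ) := by
          push_cast; ring
        rw [e, abs_le]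
        rw [abs_le] at herr' herr''
        push_cast at herr' herr'' ⊢
        simp only [hG] at herr' ⊢
        constructor <;> linarith [herr'.1, herr'.2, herr''.1, herr''.2]
      · change 0 ≤ X - (st'.2 + (F.redc I cap st'.1).2)
        linarith
    · rw [if_neg hg]
      exact ⟨n, by omega, hc', hm', herr', hρ', Or.inl hg⟩
  have hQall : ∀ k, Q k ((F.babyStepc I cap v)^[k] st) := by
    intro k
    induction k with
    | zero => exact hQ0
    | succ k ih => rw [Function.iterate_succ_apply']; exact hstep k _ ih
  obtain ⟨n, hn, hc', hm', herr', hρ', hdisj⟩ := hQall I.Bb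
  -- the number of fired steps is bounded through the six-gap
  have hgap : ∀ m : ℕ, ((m / 6 : ℕ) : ℝ) * Real.log 2 ≤ G m - G 0 := fun m =>
    log_chain_six_gap hpos hmono h6 m
  have hadv : 2 ^ I.prec * ((n / 6 : ℕ) : ℝ) * Real.log 2 - n ≤ C := by
    rw [abs_le] at herr'
    have h1 : (((F.babyStepc I cap v)^[I.Bb] st).2 - st.2 : ℤ) ≤ X - st.2 := by linarith
    have h1' : ((((F.babyStepc I cap v)^[I.Bb] st).2 - st.2 : ℤ) : ℝ) ≤ ((X - st.2 : ℤ) : ℝ) := by exact_mod_cast h1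
    have h2p : (0 : ℝ) ≤ 2 ^ I.prec := by positivity
    nlinarith [hgap n, herr'.1, h2p]
  -- the guard has failed at the end
  have hfail : ¬ (((F.babyStepc I cap v)^[I.Bb] st).2 + (F.redc I cap ((F.babyStepc I cap v)^[I.Bb] st).1).2 ≤ X) := by
    rcases hdisj with h | h
    · exact h
    · exfalso
      subst h
      have h2p : (0 : ℝ) ≤ 2 ^ I.prec := by positivity
      linarith [hgap I.Bb]
  obtain ⟨-, -, hl, -, -⟩ := stepc_chain hdeg hσ₂ ε hε hab hab1 hθ hred hcap hx₀ (n : ℤ) hc' hm'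
  refine ⟨n, hc', hm', herr', hadv, hρ', by push Not at hfail; linarith, ?_⟩
  have e : ((F.redc I cap ((F.babyStepc I cap v)^[I.Bb] st).1).2 : ℝ) =
      (((F.stepc I cap ((F.babyStepc I cap v)^[I.Bb] st)).2 - ((F.babyStepc I cap v)^[I.Bb] st).2 : ℤ) : ℝ) := by
    unfold stepc; push_cast; ring
  rw [e]; exact_mod_cast hl

end Baby

section Target

/-- **The target decomposition**: with `Rint > 0`, `t⋆ = t̂ + N · Rint` for an integer `N`, and `Rint ≤ t⋆ − pos(b_E) < 2 Rint`.
[folklore] -/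
theorem tstarc_decomp (F : WalkFns) (I : Inst) (cap v : ℕ) (hR : 0 < I.Rint) :
    ∃ N : ℤ, F.tstarc I cap v = I.tgt v + N * I.Rint ∧
      (I.Rint : ℤ) ≤ F.tstarc I cap v - (F.bEc I cap v).2 ∧ F.tstarc I cap v - (F.bEc I cap v).2 < 2 * I.Rint := by
  have hR' : (I.Rint : ℤ) ≠ 0 := by exact_mod_cast hR.ne'
  refine ⟨1 - ((I.tgt v : ℤ) - (F.bEc I cap v).2) / I.Rint, ?_, ?_, ?_⟩
  · unfold tstarc Δc
    have h := Int.emod_add_mul_ediv ((I.tgt v : ℤ) - (F.bEc I cap v).2) I.Rint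
    linear_combination h
  · unfold tstarc Δc
    have h := Int.emod_nonneg ((I.tgt v : ℤ) - (F.bEc I cap v).2) hR'
    linarith
  · unfold tstarc Δc
    have h := Int.emod_lt_of_pos ((I.tgt v : ℤ) - (F.bEc I cap v).2) (by exact_mod_cast hR : (0 : ℤ) < I.Rint)
    linarith

/-- `t̂ < Rint` (the grid target lies in the first period) when `r > 0` and `k + s ≤ prec`. [folklore] -/
theorem tgt_lt_Rint (I : Inst) (v : ℕ) (hr : 0 < I.r) (hks : I.k + I.s ≤ I.prec) : I.tgt v < I.Rint := by
  unfold Inst.tgt Inst.Rint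
  have hj : I.jof v % 2 ^ I.s < 2 ^ I.s := Nat.mod_lt _ (by positivity)
  have h2 : 2 ^ I.s * 2 ^ (I.prec - I.k - I.s) = 2 ^ (I.prec - I.k) := by
    rw [← pow_add]; congr 1; omega
  rw [← h2]
  have h1 : 0 < I.r * 2 ^ (I.prec - I.k - I.s) := by positivity
  nlinarith

end Target

end WalkFns


section Summary

/-- **Summary (registered helper of the class-group stage)**: the final guarded baby steps stop just left of the target. [cite: BuchmannWilliams1988, §3] -/
theorem cubicClassTable_babySteps_sem : ∀ (K : Type) [Field K] [NumberField K], Module.finrank ℚ K = 3 → ∀ (θ : K) (σ₁ : K →+* ℝ) (σ₂ : K →+* ℂ), (∃ z : K, starRingEnd ℂ (σ₂ z) ≠ σ₂ z) → ∀ (ε : (𝓞 K)ˣ), 1 < σ₁ (algebraMap (𝓞 K) K ε) → ∀ (F : CubicClassTable.WalkFns) (I : CubicClassTable.Inst), Squarefree (I.a * I.b) → I.a * I.b ≠ 1 → θ ^ 3 = ((I.a * I.b ^ 2 : ℕ) : K) → CubicClassTable.RedSem F I.a I.b K θ σ₁ σ₂ → ∀ (cap : ℕ), (243 * I.a ^ 2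 * I.b ^ 2) ^ 2 ≤ cap → ∀ (v : ℕ) (A : FractionalIdeal (𝓞 K)⁰ K) (x₀ : K), x₀ ∈ posRelMinima σ₁ σ₂ A → (∀ i : ℤ, 2 * σ₁ (voronoiChain σ₁ σ₂ A x₀ i) ≤ σ₁ (voronoiChain σ₁ σ₂ A x₀ (i + 6))) → ∀ (st : (ℕ × List ℤ) × ℤ), PureCubicCodes.Canon st.1 → (∀ φ : K, PureCubicCodes.Mem θ I.b st.1 φ ↔ φ ∈ FractionalIdeal.spanSingleton (𝓞 K)⁰ (voronoiChain σ₁ σ₂ A x₀ 0)⁻¹ * A) → 0 ≤ F.tstarc I cap v - st.2 → ∀ (C : ℝ), ((F.tstarc I cap v - st.2 : ℤ) : ℝ) ≤ C → C < 2 ^ I.prec * ((I.Bb / 6 : ℕ) : ℝ) * Real.log 2 - I.Bb → ∃ n : ℕ, PureCubicCodes.Canon ((F.babyStepc I cap v)^[I.Bb] st).1 ∧ (∀ φ : K, PureCubicCodes.Mem θ I.b ((F.babyStepc I cap v)^[I.Bb] st).1 φ ↔ φ ∈ FractionalIdeal.spanSingleton (𝓞 K)⁰ (voronoiChain σ₁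 σ₂ A x₀ n)⁻¹ * A) ∧ |((((F.babyStepc I cap v)^[I.Bb] st).2 - st.2 : ℤ) : ℝ) - 2 ^ I.prec * (Real.log (σ₁ (voronoiChain σ₁ σ₂ A x₀ n)) - Real.log (σ₁ (voronoiChain σ₁ σ₂ A x₀ 0)))| ≤ n ∧ 2 ^ I.prec * ((n / 6 : ℕ) : ℝ) * Real.log 2 - n ≤ C ∧ 0 ≤ F.tstarc I cap v - ((F.babyStepc I cap v)^[I.Bb] st).2 ∧ F.tstarc I cap v - ((F.babyStepc I cap v)^[I.Bb] st).2 < (F.redc I cap ((F.babyStepc I cap v)^[I.Bb] st).1).2 ∧ |((F.redc I cap ((F.babyStepc I cap v)^[I.Bb] st).1).2 : ℝ) - 2 ^ I.prec * (Real.log (σ₁ (voronoiChain σ₁ σ₂ A x₀ (n + 1))) - Real.log (σ₁ (voronoiChain σ₁ σ₂ A x₀ n)))| ≤ 1 :=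
  fun _ _ _ hdeg _ _ _ hσ₂ ε hε _ _ hab hab1 hθ hred _ hcap v _ _ hx₀ h6 _ hc hm hρ _ hC hBb =>
    WalkFns.babySteps_sem hdeg hσ₂ ε hε hab hab1 hθ hred hcap v hx₀ h6 hc hm hρ hC hBb

end Summary

end CubicClassTable

end Literature.Computability.Cryptography
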